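import Literature.AnabelianGeometry.SemiGraphs.ArithThm54CapstoneCorollaryTopology
import Literature.AnabelianGeometry.SemiGraphs.TemperedPiEdgeConjugators
import HarnessLib

/-!
# [SemiAnbd] Thm 5.4 (i) ∧ (ii) AT `π₁^temp(𝒢) ⋊^out Π_A` — the integrated corollary with the compatibility
# binder `hP` PRODUCED from the Def 5.1 (i) design data (T54-B corollary-integrator, canonical tower; proof-only)

Mochizuki, *Semi-graphs of anabelioids*, Publ. RIMS **42** (2006) 221–322, §5 Def 5.1 (i) p. 62, Prop 5.2 (iv)
p. 64, Rmk 5.3.1 p. 65, Thm 5.4 (i)(ii) p. 66 [cite: MochizukiSemiAnbd2006, Thm 5.4 (i), p. 66].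

PROOF-ONLY file (abc-iut cell, layer L3, sub-DAG `plan/L3/SUBDAG-SemiAnbd-Thm54.md`, producer row T54-B =
`plan/GAP-LEDGER.md` G-w4d053-1; row «T54·COROLLARY-INTEGRATOR» of the L3 lead's α64, seat abc-iut-w4-d089
gen 6).  No definition, no new named fact, no producer restated.  The integrated corollary at the canonical
tower — abc-iut-w4-d089's `arithMaximalCompactStatement_outerAction_piPresentation_of_producers` (p434669:
`hKst`, `hnobpNCpt`, `hR`, `hVE` bound) read in abc-iut-w6-d070's canonical level topology
(`arithMaximalCompactStatement_outerAction_piPresentation_levelTopology`, p435643: topology binders bound) —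
still carries the binder `hP` («the subgroup presentation of `𝔾` in `π₁^temp(𝒢)` is compatible with the outer
action»).  abc-iut-w4-d053's THEOREM `isArithCompatible_piPresentation_outerAction_of_branchPair`
(TemperedPiEdgeConjugators.lean, p432405) PRODUCES it from the Def 5.1 (i) design data `hV` (Prop 3.6 (iv) at
`ρ_𝔾(a)` on verticial subgroups) and `hBR` (the branch-PAIR form) alone, given Thm 3.7 (iii) at `𝒢` — a
theorem for the finite `𝔾` of the capstone's frame (`compactInVerticialAt_of_finiteGraph'`, abc-iut-L3-t8).
Here that term is substituted for `hP` everywhere (in `hK1′`, in the pinning `hinst` of the topology, in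
(AI4″) `stabBranchPairAug`):

* `arithMaximalCompactStatement_outerAction_piPresentation_levelTopology_of_branchPair` — Thm 5.4 (i) ∧ (ii)
  at `π₁^temp(𝒢) ⋊^out_{ρ'} Π_A` modulo EXACTLY: `hA` (`Π_A` tempered; abc-iut-w6-d085 «T54·hA»), the design
  data `hV`, `hE`, `hopen`, `hBR`, the finite-level Φ-stability `hLst` (not a theorem at the fixed enumeration —
  abc-iut-L3-t9; gone at the characteristic tower), the ONE continuity binder `hK1′` (abc-iut-w6-d117
  «T54·hK1′»), `noSwitchBase` / `hest` / `hbot` (print), and (AI4″) `stabBranchPairAug` (abc-iut-w4-d059).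

Nothing beyond composition is proved here; typed ≠ proved for the residual inputs; this is Thm 5.4 for OUR
tower decomposition; no side taken on [IUTchIII] Cor. 3.12.
-/

namespace Literature.AnabelianGeometry.SemiGraphs

namespace ProfiniteSemiGraph

open CategoryTheory Topology Filter
open Literature.AnabelianGeometry.EtaleTheta
open scoped Pointwise

universe u

variable {𝒢 : ProfiniteSemiGraph.{u}}

/-- **[SemiAnbd] Thm 5.4 (i) ∧ (ii) at `π₁^temp(𝒢) ⋊^out Π_A` (canonical tower, canonical level topology)
with `hP` PRODUCED** from `hV`/`hBR` by abc-iut-w4-d053's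
`isArithCompatible_piPresentation_outerAction_of_branchPair` (Thm 3.7 (iii) at the finite `𝔾`:
`compactInVerticialAt_of_finiteGraph'`): abc-iut-w6-d070's
`arithMaximalCompactStatement_outerAction_piPresentation_levelTopology` at that term.  Residual binders: `hA`,
`hV hE hopen hBR`, `hLst`, `hK1′`, `noSwitchBase`, `stabBranchPairAug`, `hest`, `hbot`.
[cite: MochizukiSemiAnbd2006, Thm 5.4 (i), p. 66] -/
theorem arithMaximalCompactStatement_outerAction_piPresentation_levelTopology_of_branchPair
    (h37 : 𝒢.Thm37Hypotheses) (hG : 𝒢.graph.IsGraph) [Finite 𝒢.graph.Vertex] [Finite 𝒢.graph.Branch]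
    {PA : Type u} [Group PA] [TopologicalSpace PA] [IsTopologicalGroup PA] [CompactSpace PA]
    (hA : IsTempered PA)
    (ρ' : PA →* TopOut (𝒢.temperedPiChart h37.toProp36Hypotheses).G) (baseAct : PA →* Aut 𝒢.graph)
    [inst : TopologicalSpace (outerSemidirectProduct ρ')]
    (T : ∀ w : 𝒢.graph.Vertex, (𝒢.galoisLevelData h37.toProp36Hypotheses).PointSeq h37.toProp36Hypotheses.isCountable w) (R : SemiGraph.RefBranches 𝒢.graph)
    (Rc : ChartRepresentatives (𝒢.temperedPiChart h37.toProp36Hypotheses))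
    (hV : ∀ (a : PA) (v : 𝒢.graph.Vertex) (H : Subgroup (𝒢.temperedPiChart h37.toProp36Hypotheses).G), H ∈ verticialSubgroups (𝒢.temperedPiChart h37.toProp36Hypotheses) v →
      ∃ φ : contMulAut (𝒢.temperedPiChart h37.toProp36Hypotheses).G, TopOut.mk (𝒢.temperedPiChart h37.toProp36Hypotheses).G φ = ρ' a ∧
        H.map (φ : MulAut (𝒢.temperedPiChart h37.toProp36Hypotheses).G).toMonoidHom ∈ verticialSubgroups (𝒢.temperedPiChart h37.toProp36Hypotheses) ((baseAct a).hom.vertexMap v))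
    (hE : ∀ (a : PA) (e : 𝒢.graph.Edge) (K : Subgroup (𝒢.temperedPiChart h37.toProp36Hypotheses).G), K ∈ edgeLikeSubgroups (𝒢.temperedPiChart h37.toProp36Hypotheses) e →
      ∃ φ : contMulAut (𝒢.temperedPiChart h37.toProp36Hypotheses).G, TopOut.mk (𝒢.temperedPiChart h37.toProp36Hypotheses).G φ = ρ' a ∧
        K.map (φ : MulAut (𝒢.temperedPiChart h37.toProp36Hypotheses).G).toMonoidHom ∈ edgeLikeSubgroups (𝒢.temperedPiChart h37.toProp36Hypotheses) ((baseAct a).hom.edgeMap e))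
    (hopen : ∃ U : Subgroup PA, IsOpen (U : Set PA) ∧ ∀ a ∈ U,
      (∀ v, (baseAct a).hom.vertexMap v = v) ∧ (∀ e, (baseAct a).hom.edgeMap e = e) ∧
        ∀ b, (baseAct a).hom.branchMap b = b)
    (hBR : ∀ (a : PA) (b : 𝒢.graph.Branch) (v : 𝒢.graph.Vertex) (hb : 𝒢.graph.abuts b = some v)
      (φ : 𝒢.Gv v →ₜ* (𝒢.temperedPiChart h37.toProp36Hypotheses).G), IsVerticialHom (𝒢.temperedPiChart h37.toProp36Hypotheses) v φ →
      ∃ Φ : contMulAut (𝒢.temperedPiChart h37.toProp36Hypotheses).G, TopOut.mk (𝒢.temperedPiChart h37.toProp36Hypotheses).G Φ = ρ' a ∧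
        ∃ φ' : 𝒢.Gv ((baseAct a).hom.vertexMap v) →ₜ* (𝒢.temperedPiChart h37.toProp36Hypotheses).G,
          IsVerticialHom (𝒢.temperedPiChart h37.toProp36Hypotheses) ((baseAct a).hom.vertexMap v) φ' ∧ ∃ x' : (𝒢.temperedPiChart h37.toProp36Hypotheses).G,
            Subgroup.map (Φ : MulAut (𝒢.temperedPiChart h37.toProp36Hypotheses).G).toMonoidHom φ.toMonoidHom.range =
              Subgroup.map (MulAut.conj x').toMonoidHom φ'.toMonoidHom.range ∧
            Subgroup.map (Φ : MulAut (𝒢.temperedPiChart h37.toProp36Hypotheses).G).toMonoidHom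
                (Subgroup.map φ.toMonoidHom (𝒢.branchSubgroup b v hb)) =
              Subgroup.map (MulAut.conj x').toMonoidHom
                (Subgroup.map φ'.toMonoidHom
                  (𝒢.branchSubgroup ((baseAct a).hom.branchMap b) ((baseAct a).hom.vertexMap v)
                    ((baseAct a).hom.abuts_branchMap b v hb))))
    (w₀ : 𝒢.graph.Vertex)
    (hLst : ∀ (n : ℕ) (e : outerSemidirectProduct ρ') (x : (𝒢.temperedPiChart h37.toProp36Hypotheses).G), x ∈ ((𝒢.galoisLevelData h37.toProp36Hypotheses).piLevelAut h37.toProp36Hypotheses.isCountable (𝒢.galoisLevelData_hconn h37.toProp36Hypotheses) n).ker → (((contMulAut (𝒢.temperedPiChart h37.toProp36Hypotheses).G).subtype.comp (MonoidHom.fst (contMulAut (𝒢.temperedPiChart h37.toProp36Hypotheses).G) PA)).comp (outerSemidirectProduct ρ').subtype) e x ∈ ((𝒢.galoisLevelData h37.toProp36Hypotheses).piLevelAut h37.toProp36Hypotheses.isCountable (𝒢.galoisLevelData_hconn h37.toProp36Hypotheses) n).ker)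
    (hK1' : ∀ n, IsOpen (((((𝒢.galoisLevelData h37.toProp36Hypotheses).piPresentation h37.toProp36Hypotheses.isCountable T R).levelKer (isArithCompatible_piPresentation_outerAction_of_branchPair h37 ρ' baseAct T R hG
        (compactInVerticialAt_of_finiteGraph' inferInstance (SemiGraph.finite_edge_of_finite_branch 𝒢.graph)) hV hBR)
        ((𝒢.galoisLevelData h37.toProp36Hypotheses).projAut h37.toProp36Hypotheses.isCountable n).ker
        ((𝒢.galoisLevelData h37.toProp36Hypotheses).hKst_of_hLst_outerAction h37.toProp36Hypotheses.isCountable (𝒢.galoisLevelData_hconn h37.toProp36Hypotheses) T R ρ' (isArithCompatible_piPresentation_outerAction_of_branchPair h37 ρ' baseAct T R hG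
        (compactInVerticialAt_of_finiteGraph' inferInstance (SemiGraph.finite_edge_of_finite_branch 𝒢.graph)) hV hBR) hLst n)).map (outerSemidirectProductSnd ρ') :
      Subgroup PA) : Set PA))
    -- the topology of `E` IS the canonical level topology (at the PRODUCED `hP`)
    (hinst : inst = canonicalArithLevelTopology h37 hA ρ' baseAct T R (isArithCompatible_piPresentation_outerAction_of_branchPair h37 ρ' baseAct T R hG
        (compactInVerticialAt_of_finiteGraph' inferInstance (SemiGraph.finite_edge_of_finite_branch 𝒢.graph)) hV hBR) w₀ hLst hK1')
    (noSwitchBase : NoBranchSwitching 𝒢.graph.edgeOf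
      (fun (a : PA) (b : 𝒢.graph.Branch) => (baseAct a).hom.branchMap b))
    (stabBranchPairAug : ∀ (C : Subgroup (outerSemidirectProduct ρ')),
      IsCompact (C : Set (outerSemidirectProduct ρ')) →
      ∀ (j₀ : ℕ) (w : ∀ i : {i : ℕ // j₀ ≤ i}, (((𝒢.galoisLevelData h37.toProp36Hypotheses).piPresentation h37.toProp36Hypotheses.isCountable T R).cosetGraph ((𝒢.galoisLevelData h37.toProp36Hypotheses).piLevelAut h37.toProp36Hypotheses.isCountable (𝒢.galoisLevelData_hconn h37.toProp36Hypotheses) i.1).ker).Vertex)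
      (β β' : ∀ i : {i : ℕ // j₀ ≤ i}, (((𝒢.galoisLevelData h37.toProp36Hypotheses).piPresentation h37.toProp36Hypotheses.isCountable T R).cosetGraph ((𝒢.galoisLevelData h37.toProp36Hypotheses).piLevelAut h37.toProp36Hypotheses.isCountable (𝒢.galoisLevelData_hconn h37.toProp36Hypotheses) i.1).ker).Branch),
      (∀ i, β i ≠ β' i ∧ (((𝒢.galoisLevelData h37.toProp36Hypotheses).piPresentation h37.toProp36Hypotheses.isCountable T R).cosetGraph ((𝒢.galoisLevelData h37.toProp36Hypotheses).piLevelAut h37.toProp36Hypotheses.isCountable (𝒢.galoisLevelData_hconn h37.toProp36Hypotheses) i.1).ker).abuts (β i) = some (w i) ∧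
        (((𝒢.galoisLevelData h37.toProp36Hypotheses).piPresentation h37.toProp36Hypotheses.isCountable T R).cosetGraph ((𝒢.galoisLevelData h37.toProp36Hypotheses).piLevelAut h37.toProp36Hypotheses.isCountable (𝒢.galoisLevelData_hconn h37.toProp36Hypotheses) i.1).ker).abuts (β' i) = some (w i)) →
      (∀ ⦃i i' : {i : ℕ // j₀ ≤ i}⦄ (h : i.1 ≤ i'.1),
        (((𝒢.galoisLevelData h37.toProp36Hypotheses).piPresentation h37.toProp36Hypotheses.isCountable T R).cosetGraphTrans ((𝒢.galoisLevelData h37.toProp36Hypotheses).ker_piLevelAut_anti h37.toProp36Hypotheses.isCountable (𝒢.galoisLevelData_hconn h37.toProp36Hypotheses) h)).vertexMap (w i') = w i ∧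
        (((𝒢.galoisLevelData h37.toProp36Hypotheses).piPresentation h37.toProp36Hypotheses.isCountable T R).cosetGraphTrans ((𝒢.galoisLevelData h37.toProp36Hypotheses).ker_piLevelAut_anti h37.toProp36Hypotheses.isCountable (𝒢.galoisLevelData_hconn h37.toProp36Hypotheses) h)).branchMap (β i') = β i ∧
          (((𝒢.galoisLevelData h37.toProp36Hypotheses).piPresentation h37.toProp36Hypotheses.isCountable T R).cosetGraphTrans ((𝒢.galoisLevelData h37.toProp36Hypotheses).ker_piLevelAut_anti h37.toProp36Hypotheses.isCountable (𝒢.galoisLevelData_hconn h37.toProp36Hypotheses) h)).branchMap (β' i') = β' i) →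
      (∀ (i : {i : ℕ // j₀ ≤ i}) (g : outerSemidirectProduct ρ'), g ∈ C →
        (((𝒢.galoisLevelData h37.toProp36Hypotheses).piPresentation h37.toProp36Hypotheses.isCountable T R).arithAct (isArithCompatible_piPresentation_outerAction_of_branchPair h37 ρ' baseAct T R hG
        (compactInVerticialAt_of_finiteGraph' inferInstance (SemiGraph.finite_edge_of_finite_branch 𝒢.graph)) hV hBR) ((𝒢.galoisLevelData h37.toProp36Hypotheses).piLevelAut h37.toProp36Hypotheses.isCountable (𝒢.galoisLevelData_hconn h37.toProp36Hypotheses) i.1).ker (hLst i.1) g).hom.vertexMap (w i) = w i ∧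
        (((𝒢.galoisLevelData h37.toProp36Hypotheses).piPresentation h37.toProp36Hypotheses.isCountable T R).arithAct (isArithCompatible_piPresentation_outerAction_of_branchPair h37 ρ' baseAct T R hG
        (compactInVerticialAt_of_finiteGraph' inferInstance (SemiGraph.finite_edge_of_finite_branch 𝒢.graph)) hV hBR) ((𝒢.galoisLevelData h37.toProp36Hypotheses).piLevelAut h37.toProp36Hypotheses.isCountable (𝒢.galoisLevelData_hconn h37.toProp36Hypotheses) i.1).ker (hLst i.1) g).hom.branchMap (β i) = β i ∧
          (((𝒢.galoisLevelData h37.toProp36Hypotheses).piPresentation h37.toProp36Hypotheses.isCountable T R).arithAct (isArithCompatible_piPresentation_outerAction_of_branchPair h37 ρ' baseAct T R hG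
        (compactInVerticialAt_of_finiteGraph' inferInstance (SemiGraph.finite_edge_of_finite_branch 𝒢.graph)) hV hBR) ((𝒢.galoisLevelData h37.toProp36Hypotheses).piLevelAut h37.toProp36Hypotheses.isCountable (𝒢.galoisLevelData_hconn h37.toProp36Hypotheses) i.1).ker (hLst i.1) g).hom.branchMap (β' i) = β' i) →
      ∃ (v : 𝒢.graph.Vertex) (b b' : 𝒢.graph.Branch) (a : PA) (h : outerSemidirectProduct ρ'),
        (decompositionDataOfChart Rc (toOuterSemidirectProduct ρ')).abut b = some v ∧ (decompositionDataOfChart Rc (toOuterSemidirectProduct ρ')).abut b' = some v ∧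
        h ∈ (decompositionDataOfChart Rc (toOuterSemidirectProduct ρ')).vertGp v ∧ (b' ≠ b ∨ h ∉ (decompositionDataOfChart Rc (toOuterSemidirectProduct ρ')).brGp b) ∧
        C.map (outerSemidirectProductSnd ρ') ≤ conjSubgroup a (((decompositionDataOfChart Rc (toOuterSemidirectProduct ρ')).brGp b ⊓
          conjSubgroup h ((decompositionDataOfChart Rc (toOuterSemidirectProduct ρ')).brGp b')).map (outerSemidirectProductSnd ρ')))
    (hest : IsTotallyArithEstranged (decompositionDataOfChart Rc (toOuterSemidirectProduct ρ')) (outerSemidirectProductSnd ρ')) (hbot : ¬ IsArithAmple (outerSemidirectProductSnd ρ') ⊥) :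
    ArithMaximalCompactStatementI (decompositionDataOfChart Rc (toOuterSemidirectProduct ρ')) (outerSemidirectProductSnd ρ') ∧
      ArithMaximalCompactStatementII (decompositionDataOfChart Rc (toOuterSemidirectProduct ρ')) (outerSemidirectProductSnd ρ') :=
  arithMaximalCompactStatement_outerAction_piPresentation_levelTopology h37 hG hA ρ' baseAct T R Rc hV hE hopen
    hBR _ w₀ hLst hK1' hinst noSwitchBase stabBranchPairAug hest hbot

end ProfiniteSemiGraph

end Literature.AnabelianGeometry.SemiGraphs
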